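import Mathlib.Analysis.SpecialFunctions.Integrals.LogTrigonometric
import Mathlib.Analysis.SpecialFunctions.Integrals.Basic
import Mathlib.Analysis.SpecialFunctions.Trigonometric.Chebyshev.Basic
import Mathlib.Analysis.SpecialFunctions.Log.NegMulLog
import Mathlib.MeasureTheory.Integral.IntervalIntegral.FundThmCalculus
import Mathlib.Topology.Algebra.Polynomial

/-!
# Stubs `stub_logTwoSinHalf_cos_integral`, `stub_logTwoSinHalf_integral_zero` (line `Sketch`, B7/P3)

Crux `WeilComb.CombShapePositivity` (item stmt-RiemannHypothesis-11229), line `Sketch`, lead c3,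
plan B7 (major-arc lemma for the harmonic Toeplitz form `Σ_{m ≠ m'} b_m b̄_{m'} / |m − m'|`),
piece P3: the Fourier cosine coefficients of `θ ↦ log (2 sin (θ/2))` on `[0, π]`, i.e. the
classical expansion `log (2 sin (θ/2)) = −Σ_{n ≥ 1} cos (nθ)/n` in integrated form:

* `stub_logTwoSinHalf_cos_integral` — `∫_0^π cos (dθ) log (2 sin (θ/2)) dθ = −π/(2d)` for every
  integer `d ≥ 1`;
* `stub_logTwoSinHalf_integral_zero` — `∫_0^π log (2 sin (θ/2)) dθ = 0`.

Proof (elementary, Mathlib only; no Fourier-series convergence and no endpoint limits).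
For `d ≥ 1` put `G(θ) = sin (dθ) · log (2 sin (θ/2))`. By the Chebyshev identity
`U_{2d−1}(cos (θ/2)) · sin (θ/2) = sin (dθ)` (Mathlib's `Polynomial.Chebyshev.U_real_cos`),
`G = U_{2d−1}(cos (θ/2)) · [sin (θ/2) log (2 sin (θ/2))]` is continuous on all of `ℝ`
(`x log x` is continuous, `Real.continuous_mul_log`; Lean's junk value `log 0 = 0` is the genuine
limit here), and `G(0) = G(π) = 0`. On `(0, π)` the Dirichlet-kernel identity
`sin (dθ) cos (θ/2) = sin (θ/2) · D_d(θ)`, `D_d(θ) = 1 + 2 Σ_{1 ≤ k ≤ d} cos (kθ) − cos (dθ)`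
(`sin_mul_cos_half_eq_p3`, induction on `d`) gives `G' = d cos (dθ) log (2 sin (θ/2)) + D_d/2`,
an integrable function (`log ∘ (2 sin (·/2))` is the log of a real-analytic function,
`MeromorphicOn.intervalIntegrable_log`). The fundamental theorem of calculus
(`intervalIntegral.integral_eq_sub_of_hasDerivAt_of_le`) and `∫_0^π D_d = π`
(`∫_0^π cos (kθ) dθ = 0` for `k ≥ 1`) give `d · ∫_0^π cos (dθ) log (2 sin (θ/2)) dθ + π/2 = 0`.
For `d = 0`: the substitution `θ = 2u` and `log (2 sin u) = log 2 + log (sin u)` on `(0, π/2)`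
reduce the claim to Mathlib's `integral_log_sin_zero_pi_div_two : ∫_0^{π/2} log (sin u) du =
−(log 2) π/2`.
-/

noncomputable section

-- the sub-problem path RiemannHypothesis/RiemannHypothesis duplicates a namespace (D-0017)
set_option linter.dupNamespace false

open MeasureTheory Set Filter intervalIntegral
open scoped Real Topology Interval

namespace Summit.RiemannHypothesis.RiemannHypothesis.Theorems.WeilCombBohrFejer

/-! ### Trigonometric preliminaries -/

/-- The Dirichlet-kernel identity `sin (dθ) cos (θ/2) = sin (θ/2) (1 + 2 Σ_{k<d} cos ((k+1)θ) − cos (dθ))`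
for every natural `d` and real `θ` (induction on `d`). [folklore] -/
theorem sin_mul_cos_half_eq_p3 (d : ℕ) (θ : ℝ) :
    Real.sin (d * θ) * Real.cos (θ / 2) =
      Real.sin (θ / 2) *
        (1 + 2 * ∑ k ∈ Finset.range d, Real.cos ((k + 1) * θ) - Real.cos (d * θ)) := by
  have h2 : θ = 2 * (θ / 2) := by ring
  have hcθ : Real.cos θ = 2 * Real.cos (θ / 2) ^ 2 - 1 := by
    conv_lhs => rw [h2]
    exact Real.cos_two_mul (θ / 2)
  have hsθ : Real.sin θ = 2 * Real.sin (θ / 2) * Real.cos (θ / 2) := by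
    conv_lhs => rw [h2]
    exact Real.sin_two_mul (θ / 2)
  have pyth := Real.sin_sq_add_cos_sq (θ / 2)
  induction d with
  | zero => simp
  | succ d ih =>
    rw [Finset.sum_range_succ]
    push_cast
    rw [add_mul, one_mul, Real.sin_add, Real.cos_add, hcθ, hsθ]
    linear_combination ih + 2 * Real.sin (d * θ) * Real.cos (θ / 2) * pyth

/-- `∫_0^π cos (nθ) dθ = 0` for a natural number `n ≥ 1`. [folklore] -/
theorem integral_cos_nat_mul_zero_pi_p3 {n : ℕ} (hn : n ≠ 0) :
    ∫ θ in (0 : ℝ)..π, Real.cos (n * θ) = 0 := by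
  have hn' : (n : ℝ) ≠ 0 := Nat.cast_ne_zero.2 hn
  have hd : ∀ x ∈ uIcc (0 : ℝ) π,
      HasDerivAt (fun v => Real.sin (n * v) / n) (Real.cos (n * x)) x := by
    intro x _
    have h1 : HasDerivAt (fun v : ℝ => (n : ℝ) * v) (n : ℝ) x := by
      simpa using (hasDerivAt_id x).const_mul (n : ℝ)
    have h3 := ((Real.hasDerivAt_sin ((n : ℝ) * x)).comp x h1).div_const (n : ℝ)
    refine h3.congr_deriv ?_
    rw [mul_div_assoc, div_self hn', mul_one]
  rw [integral_eq_sub_of_hasDerivAt hd (by apply Continuous.intervalIntegrable; fun_prop)]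
  simp [Real.sin_nat_mul_pi]

/-- `∫_0^π (1 + 2 Σ_{k<d} cos ((k+1)θ) − cos (dθ)) dθ = π` for `d ≥ 1` (all the cosine integrals
vanish). [folklore] -/
theorem integral_dirichletComb_zero_pi_p3 {d : ℕ} (hd : d ≠ 0) :
    ∫ θ in (0 : ℝ)..π,
        (1 + 2 * ∑ k ∈ Finset.range d, Real.cos ((k + 1) * θ) - Real.cos (d * θ)) = π := by
  have hck : ∀ k : ℕ, IntervalIntegrable (fun θ : ℝ => Real.cos ((k + 1) * θ)) volume 0 π :=
    fun k => by apply Continuous.intervalIntegrable; fun_prop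
  have hsum : IntervalIntegrable
      (fun θ : ℝ => ∑ k ∈ Finset.range d, Real.cos ((k + 1) * θ)) volume 0 π := by
    apply Continuous.intervalIntegrable; fun_prop
  have h1 : IntervalIntegrable
      (fun θ : ℝ => 1 + 2 * ∑ k ∈ Finset.range d, Real.cos ((k + 1) * θ)) volume 0 π :=
    intervalIntegrable_const.add (hsum.const_mul 2)
  have hcd : IntervalIntegrable (fun θ : ℝ => Real.cos (d * θ)) volume 0 π := by
    apply Continuous.intervalIntegrable; fun_prop
  have hzero : ∀ k ∈ Finset.range d, ∫ θ in (0 : ℝ)..π, Real.cos ((k + 1) * θ) = 0 := by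
    intro k _
    have := integral_cos_nat_mul_zero_pi_p3 (Nat.succ_ne_zero k)
    push_cast at this
    exact this
  rw [intervalIntegral.integral_sub h1 hcd, intervalIntegral.integral_add intervalIntegrable_const
    (hsum.const_mul 2), intervalIntegral.integral_const_mul,
    intervalIntegral.integral_finsetSum fun k _ => hck k, Finset.sum_eq_zero hzero,
    integral_cos_nat_mul_zero_pi_p3 hd, intervalIntegral.integral_const]
  simp

/-! ### The function `θ ↦ log (2 sin (θ/2))` -/

/-- `θ ↦ log (2 sin (θ/2))` is integrable on every bounded interval (log of a real-analytic
function, `MeromorphicOn.intervalIntegrable_log`). [folklore] -/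
theorem intervalIntegrable_logTwoSinHalf_p3 (a b : ℝ) :
    IntervalIntegrable (fun θ : ℝ => Real.log (2 * Real.sin (θ / 2))) volume a b := by
  have h : MeromorphicOn (fun θ : ℝ => 2 * Real.sin (θ / 2)) (uIcc a b) := fun x _ => by
    apply AnalyticAt.meromorphicAt
    fun_prop
  exact h.intervalIntegrable_log

/-- `θ ↦ sin (dθ) log (2 sin (θ/2))` is continuous on `ℝ`: by the Chebyshev identity
`sin (dθ) = U_{2d−1}(cos (θ/2)) sin (θ/2)` it is `U_{2d−1}(cos (θ/2)) · ((x log x) ∘ (2 sin (·/2)))/2`.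
[folklore] -/
theorem continuous_sin_mul_logTwoSinHalf_p3 (d : ℕ) :
    Continuous fun θ : ℝ => Real.sin (d * θ) * Real.log (2 * Real.sin (θ / 2)) := by
  have hU : ∀ θ : ℝ, Real.sin (d * θ) =
      (Polynomial.Chebyshev.U ℝ (2 * d - 1 : ℤ)).eval (Real.cos (θ / 2)) * Real.sin (θ / 2) := by
    intro θ
    rw [Polynomial.Chebyshev.U_real_cos]
    congr 1
    push_cast
    ring
  have hml : Continuous fun θ : ℝ => 2 * Real.sin (θ / 2) * Real.log (2 * Real.sin (θ / 2)) :=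
    Real.continuous_mul_log.comp (by fun_prop : Continuous fun θ : ℝ => 2 * Real.sin (θ / 2))
  have hP : Continuous fun θ : ℝ =>
      (Polynomial.Chebyshev.U ℝ (2 * d - 1 : ℤ)).eval (Real.cos (θ / 2)) :=
    (Polynomial.continuous _).comp (by fun_prop)
  have heq : (fun θ : ℝ => Real.sin (d * θ) * Real.log (2 * Real.sin (θ / 2))) =
      fun θ => (Polynomial.Chebyshev.U ℝ (2 * d - 1 : ℤ)).eval (Real.cos (θ / 2)) *
        (1 / 2 * (2 * Real.sin (θ / 2) * Real.log (2 * Real.sin (θ / 2)))) := by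
    funext θ
    rw [hU θ]
    ring
  rw [heq]
  exact hP.mul (continuous_const.mul hml)

/-- On `(0, π)`: `(sin (dθ) log (2 sin (θ/2)))' = d cos (dθ) log (2 sin (θ/2)) + D_d(θ)/2` with
`D_d(θ) = 1 + 2 Σ_{k<d} cos ((k+1)θ) − cos (dθ)` (product rule and the Dirichlet-kernel identity,
`sin (θ/2) ≠ 0`). [folklore] -/
theorem hasDerivAt_sin_mul_logTwoSinHalf_p3 (d : ℕ) {θ : ℝ} (hθ : θ ∈ Ioo (0 : ℝ) π) :
    HasDerivAt (fun θ : ℝ => Real.sin (d * θ) * Real.log (2 * Real.sin (θ / 2)))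
      (d * Real.cos (d * θ) * Real.log (2 * Real.sin (θ / 2)) +
        (1 + 2 * ∑ k ∈ Finset.range d, Real.cos ((k + 1) * θ) - Real.cos (d * θ)) / 2) θ := by
  have hs : 0 < Real.sin (θ / 2) :=
    Real.sin_pos_of_pos_of_lt_pi (by linarith [hθ.1]) (by linarith [hθ.2, Real.pi_pos])
  have h1 : HasDerivAt (fun v : ℝ => Real.sin (d * v)) (d * Real.cos (d * θ)) θ := by
    have hlin : HasDerivAt (fun v : ℝ => (d : ℝ) * v) (d : ℝ) θ := by
      simpa using (hasDerivAt_id θ).const_mul (d : ℝ)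
    have h : HasDerivAt (fun v : ℝ => Real.sin (d * v)) (Real.cos (d * θ) * d) θ :=
      (Real.hasDerivAt_sin ((d : ℝ) * θ)).comp θ hlin
    exact h.congr_deriv (by ring)
  have h2 : HasDerivAt (fun v : ℝ => 2 * Real.sin (v / 2)) (Real.cos (θ / 2)) θ := by
    have hlin : HasDerivAt (fun v : ℝ => v / 2) (1 / 2 : ℝ) θ := (hasDerivAt_id θ).div_const 2
    have h0 := (Real.hasDerivAt_sin (θ / 2)).comp θ hlin
    have h : HasDerivAt (fun v : ℝ => 2 * Real.sin (v / 2)) (2 * (Real.cos (θ / 2) * (1 / 2))) θ :=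
      h0.const_mul (2 : ℝ)
    exact h.congr_deriv (by ring)
  have h3 : HasDerivAt (fun v : ℝ => Real.log (2 * Real.sin (v / 2)))
      (Real.cos (θ / 2) / (2 * Real.sin (θ / 2))) θ := h2.log (by positivity)
  have key := sin_mul_cos_half_eq_p3 d θ
  have hne : Real.sin (θ / 2) ≠ 0 := hs.ne'
  refine (h1.mul h3).congr_deriv ?_
  rw [add_right_inj, mul_div_assoc', key]
  field_simp

/-! ### The two registered statements -/

/-- **Fourier cosine coefficients of `log (2 sin (θ/2))`**: for every integer `d ≥ 1`,
`∫_0^π cos (dθ) log (2 sin (θ/2)) dθ = −π/(2d)` (the integrated form of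
`log (2 sin (θ/2)) = −Σ_{n ≥ 1} cos (nθ)/n`). [folklore] -/
theorem stub_logTwoSinHalf_cos_integral : ∀ d : ℕ, 1 ≤ d → ∫ θ in (0 : ℝ)..Real.pi, Real.cos (d * θ) * Real.log (2 * Real.sin (θ / 2)) = -Real.pi / (2 * d) := by
  intro d hd
  have hd0 : d ≠ 0 := Nat.one_le_iff_ne_zero.mp hd
  have hdR : (0 : ℝ) < d := Nat.cast_pos.mpr (Nat.pos_of_ne_zero hd0)
  have hLint := intervalIntegrable_logTwoSinHalf_p3 0 π
  have hint1 : IntervalIntegrable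
      (fun θ : ℝ => d * Real.cos (d * θ) * Real.log (2 * Real.sin (θ / 2))) volume 0 π :=
    hLint.continuousOn_mul (by fun_prop)
  have hint2 : IntervalIntegrable (fun θ : ℝ =>
      (1 + 2 * ∑ k ∈ Finset.range d, Real.cos ((k + 1) * θ) - Real.cos (d * θ)) / 2)
      volume 0 π := by
    apply Continuous.intervalIntegrable; fun_prop
  have hFTC := intervalIntegral.integral_eq_sub_of_hasDerivAt_of_le Real.pi_pos.le
    (continuous_sin_mul_logTwoSinHalf_p3 d).continuousOn
    (fun θ hθ => hasDerivAt_sin_mul_logTwoSinHalf_p3 d hθ) (hint1.add hint2)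
  rw [intervalIntegral.integral_add hint1 hint2, intervalIntegral.integral_div,
    integral_dirichletComb_zero_pi_p3 hd0, Real.sin_nat_mul_pi] at hFTC
  have hmain : ∫ θ in (0 : ℝ)..π, d * Real.cos (d * θ) * Real.log (2 * Real.sin (θ / 2)) =
      d * ∫ θ in (0 : ℝ)..π, Real.cos (d * θ) * Real.log (2 * Real.sin (θ / 2)) := by
    rw [← intervalIntegral.integral_const_mul]
    congr 1
    funext θ
    ring
  rw [hmain] at hFTC
  simp only [mul_zero, Real.sin_zero, zero_mul, sub_self] at hFTC
  rw [eq_div_iff (by positivity)]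
  linarith

/-- **The mean of `log (2 sin (θ/2))` vanishes**: `∫_0^π log (2 sin (θ/2)) dθ = 0` (substitute
`θ = 2u` and use `∫_0^{π/2} log (sin u) du = −(log 2) π/2`). [folklore] -/
theorem stub_logTwoSinHalf_integral_zero : ∫ θ in (0 : ℝ)..Real.pi, Real.log (2 * Real.sin (θ / 2)) = 0 := by
  have hsub : ∫ θ in (0 : ℝ)..π, Real.log (2 * Real.sin (θ / 2)) =
      2 * ∫ u in (0 : ℝ)..π / 2, Real.log (2 * Real.sin u) := by
    have := intervalIntegral.integral_comp_div (a := 0) (b := π)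
      (fun u => Real.log (2 * Real.sin u)) (two_ne_zero (α := ℝ))
    simpa using this
  have heq : EqOn (fun u => Real.log (2 * Real.sin u)) (fun u => Real.log 2 + Real.log (Real.sin u))
      (uIoo 0 (π / 2)) := by
    intro u hu
    rw [uIoo_of_le (by positivity)] at hu
    have hs : 0 < Real.sin u :=
      Real.sin_pos_of_pos_of_lt_pi hu.1 (by linarith [hu.2, Real.pi_pos])
    simp only
    rw [Real.log_mul two_ne_zero hs.ne']
  have hls : IntervalIntegrable (fun u => Real.log (Real.sin u)) volume 0 (π / 2) :=
    intervalIntegrable_log_sin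
  rw [hsub, intervalIntegral.integral_congr_uIoo heq,
    intervalIntegral.integral_add intervalIntegrable_const hls, intervalIntegral.integral_const,
    integral_log_sin_zero_pi_div_two]
  simp only [sub_zero, smul_eq_mul]
  ring

/-- The normalised form consumed by the major-arc lemma: for `d ≥ 1`,
`(1/π) ∫_0^π cos (dθ) · (−2 log (2 sin (θ/2))) dθ = 1/d`. [folklore] -/
theorem logTwoSinHalf_cos_coeff_p3 {d : ℕ} (hd : 1 ≤ d) :
    1 / π * ∫ θ in (0 : ℝ)..π, Real.cos (d * θ) * (-2 * Real.log (2 * Real.sin (θ / 2))) =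
      1 / d := by
  have h := stub_logTwoSinHalf_cos_integral d hd
  have hdR : (0 : ℝ) < d := Nat.cast_pos.mpr hd
  have hre : (fun θ : ℝ => Real.cos (d * θ) * (-2 * Real.log (2 * Real.sin (θ / 2)))) =
      fun θ => -2 * (Real.cos (d * θ) * Real.log (2 * Real.sin (θ / 2))) := by
    funext θ; ring
  rw [hre, intervalIntegral.integral_const_mul, h]
  field_simp
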